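import Literature.AlgebraicGeometry.Resolution.TameCyclicInvariants
import Mathlib.Algebra.Ring.Aut
import Mathlib.Algebra.Algebra.Basic
import HarnessLib

/-!
# The fixed ring of a tame cyclic automorphism: finiteness, Noetherianity, locality, and regularity for a pseudo-reflection

Topic: `Literature/AlgebraicGeometry/Resolution`. PROOF side of `CossartPiltant2019ReductionP`
(`ArithmeticalThreefoldsLocal.lean`), third brick (after `TameCyclicInvariants.lean` and
`TameCyclicEigenparameters.lean`) of its one remaining input (C4) — descent of local
uniformization below the ramification field ([CoP1] Prop. 9.3/9.5 with Lemma 9.4). Brick 1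
(`isRegularLocalRing_of_fixed_pseudoReflection`) proves that the ring of invariants of a tame
cyclic group acting on a regular local ring by a pseudo-reflection is regular — the statement
"`Ŝ₁^G = κ(S₁)[[z₁^l, z₂, z₃]]` is a regular local ring. Thus `S₁^G` is a local uniformization of
`V/k`" of the proof of [CoP1] Lemma 9.4 (HAL p. 29) — but for an ABSTRACT finite extension
`A → B` with `A` Noetherian local, fixed ring `A` and equal residue fields. In the source `A` IS
the fixed ring `R₁ := S₁^G` ("`R₁` is a normal local model of `V/k` and `S₁` lies above `R₁`. By
proposition 6.2, we have `κ(R₁) = κ(S₁)`"), and those standing hypotheses are properties of the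
fixed ring of a tame cyclic automorphism. This file proves them, with the Reynolds operator
`P₀ = ∑ᵢ σⁱ` and its twists, and restates brick 1 for the fixed subring itself:

* `module_finite_fixedSubring_of_tameCyclic` — PROVED: `B` Noetherian ⇒ `B` is a finite module
  over the fixed subring `A = B^σ` (each weight-`k` eigen-ideal is generated by finitely many
  eigenvectors, over which every weight-`k` eigenvector is an `A`-combination: apply `P_k`).
* `isNoetherianRing_fixedSubring_of_tameCyclic` — PROVED: `B` Noetherian ⇒ `A` Noetherian
  (`I·B ∩ A = I` by the Reynolds operator).
* `isLocalRing_fixedSubring` — PROVED: `B` local ⇒ `A` local, and units of `A` are the elements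
  that are units of `B` (`isUnit_fixedSubring_iff`).
* `exists_sub_mem_maximalIdeal_of_residuallyTrivial` — PROVED: if `σ` acts trivially on the
  residue field (`σ b − b ∈ 𝔪_B`; in the source: `G = Gⁱ` is the inertia group), then
  `κ(A) → κ(B)` is onto: `b − ℓ⁻¹ P₀ b ∈ 𝔪_B`.
* `isRegularLocalRing_fixedSubring_of_pseudoReflection` — PROVED, brick 1 made self-contained:
  for `B` regular local of dimension `d + 1`, `σ` of order dividing `ℓ` with `ℓ ∈ Bˣ`, `ζ ∈ B`
  fixed with `ζ^ℓ = 1`, `ζ^k − 1 ∈ Bˣ` (`0 < k < ℓ`), residually trivial, and a regular system of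
  parameters `(z₀, z₁, …, z_d)` with `σ z₀ = ζ z₀`, `σ zⱼ = zⱼ`: the fixed subring `A` is a regular
  local ring with `𝔪_A = (z₀^ℓ, z₁, …, z_d)`.

Everything is PROVED; no named facts are introduced. The fixed ring enters as any subring `A`
with `b ∈ A ↔ σ b = b` (e.g. `RingHom.eqLocus`), so that consumers may use their own packaging.

## Sources

* V. Cossart, O. Piltant, *Resolution of singularities of threefolds in positive characteristic.
  I*, J. Algebra 320 (2008) 1051–1082: Prop. 6.2 and proof of Lemma 9.4 (HAL hal-00139124,
  pp. 17–19 and 28–29). [CossartPiltant2008]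
-/

noncomputable section

open IsLocalRing

namespace Literature.AlgebraicGeometry.Resolution

universe u

section FixedRing

variable {B : Type u} [CommRing B] (σ : B ≃+* B)

/-! ## Reynolds operators (private engine) -/

/-- `σⁱ e = ζ^{ki} e` for an eigenvector `e` of weight `k`. [folklore] -/
private theorem pow_apply_eigen {ζ e : B} (hσζ : σ ζ = ζ) {k : ℕ} (he : σ e = ζ ^ k * e) (i : ℕ) :
    (σ ^ i) e = ζ ^ (k * i) * e := by
  induction i with
  | zero => simp
  | succ i ih =>
    rw [pow_succ', RingAut.mul_apply, ih, map_mul, map_pow, hσζ, he, ← mul_assoc, ← pow_add,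
      show k * i + k = k * (i + 1) by ring]

/-- `σⁱ` preserves the maximal ideal of a local ring. [folklore] -/
private theorem pow_apply_mem_maximalIdeal [IsLocalRing B] (i : ℕ) {b : B}
    (hb : b ∈ maximalIdeal B) : (σ ^ i) b ∈ maximalIdeal B := by
  rw [IsLocalRing.mem_maximalIdeal, mem_nonunits_iff] at hb ⊢
  intro hu
  apply hb
  have := hu.map (σ ^ i).symm
  rwa [RingEquiv.symm_apply_apply] at this

/-- The twisted Reynolds operator `P_k = ∑ᵢ η^{ki} σⁱ` (`η = ζ⁻¹`) on a product with an
eigenvector `e` of weight `k`: `P_k (c e) = P₀(c) e`. [folklore] -/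
private theorem twistedSum_mul_eigen {ℓ : ℕ} {ζ η e : B} (hηζ : η * ζ = 1) (hσζ : σ ζ = ζ) {k : ℕ}
    (he : σ e = ζ ^ k * e) (c : B) :
    (∑ i ∈ Finset.range ℓ, η ^ (k * i) * (σ ^ i) (c * e)) =
      (∑ i ∈ Finset.range ℓ, (σ ^ i) c) * e := by
  rw [Finset.sum_mul]
  refine Finset.sum_congr rfl fun i _ => ?_
  rw [map_mul, pow_apply_eigen σ hσζ he i, ← mul_assoc, ← mul_assoc, mul_right_comm (η ^ (k * i)),
    ← mul_pow, hηζ, one_pow, one_mul]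

/-- `σ (P₀ b) = P₀ b` when `σ^ℓ = 1`: the Reynolds operator has fixed values. [folklore] -/
private theorem apply_sum_pow_apply {ℓ : ℕ} (hℓ0 : ℓ ≠ 0) (hσℓ : σ ^ ℓ = 1) (b : B) :
    σ (∑ i ∈ Finset.range ℓ, (σ ^ i) b) = ∑ i ∈ Finset.range ℓ, (σ ^ i) b := by
  rw [map_sum]
  let f : ℕ → B := fun i => (σ ^ i) b
  have hf : ∀ i, σ ((σ ^ i) b) = f (i + 1) := fun i => by
    change σ ((σ ^ i) b) = (σ ^ (i + 1)) b
    rw [pow_succ', RingAut.mul_apply]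
  simp only [hf]
  have hfℓ : f ℓ = f 0 := by
    change (σ ^ ℓ) b = (σ ^ 0) b
    rw [hσℓ, pow_zero]
  obtain ⟨m, hm⟩ : ∃ m, ℓ = m + 1 := ⟨ℓ - 1, by omega⟩
  rw [hm, Finset.sum_range_succ' f, Finset.sum_range_succ (fun x => f (x + 1)), ← hm, hfℓ]

/-- `σ (P_k b) = ζ^k P_k b`: the twisted Reynolds operator produces eigenvectors of weight `k`.
[folklore] -/
private theorem apply_twistedSum {ℓ : ℕ} (hℓ0 : ℓ ≠ 0) (hσℓ : σ ^ ℓ = 1) {ζ η : B}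
    (hηζ : η * ζ = 1) (hση : σ η = η) (hηℓ : η ^ ℓ = 1) (k : ℕ) (b : B) :
    σ (∑ i ∈ Finset.range ℓ, η ^ (k * i) * (σ ^ i) b) =
      ζ ^ k * ∑ i ∈ Finset.range ℓ, η ^ (k * i) * (σ ^ i) b := by
  rw [map_sum, Finset.mul_sum]
  let f : ℕ → B := fun i => (ζ ^ k * η ^ (k * i)) * (σ ^ i) b
  have hf : ∀ i, σ (η ^ (k * i) * (σ ^ i) b) = f (i + 1) := by
    intro i
    rw [map_mul, map_pow, hση, show σ ((σ ^ i) b) = (σ ^ (i + 1)) b by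
      rw [pow_succ', RingAut.mul_apply]]
    change _ = (ζ ^ k * η ^ (k * (i + 1))) * (σ ^ (i + 1)) b
    congr 1
    rw [mul_add, mul_one, pow_add, ← mul_assoc, mul_comm (ζ ^ k), mul_assoc, ← mul_pow,
      mul_comm ζ η, hηζ, one_pow, mul_one]
  have hg : ∀ i, ζ ^ k * (η ^ (k * i) * (σ ^ i) b) = f i := by
    intro i
    change _ = (ζ ^ k * η ^ (k * i)) * (σ ^ i) b
    rw [mul_assoc]
  simp only [hf, hg]
  have hfℓ : f ℓ = f 0 := by
    change (ζ ^ k * η ^ (k * ℓ)) * (σ ^ ℓ) b = (ζ ^ k * η ^ (k * 0)) * (σ ^ 0) b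
    rw [mul_comm k ℓ, pow_mul, hηℓ, one_pow, mul_zero, pow_zero, hσℓ, pow_zero]
  obtain ⟨m, hm⟩ : ∃ m, ℓ = m + 1 := ⟨ℓ - 1, by omega⟩
  rw [hm, Finset.sum_range_succ' f, Finset.sum_range_succ (fun x => f (x + 1)), ← hm, hfℓ]

/-- `∑_k P_k b = ℓ b`: the character sums `∑_k η^{ki}` vanish for `0 < i < ℓ`. [folklore] -/
private theorem sum_twistedSum {ℓ : ℕ} (hℓ0 : ℓ ≠ 0) {ζ η : B} (hηζ : η * ζ = 1) (hηℓ : η ^ ℓ = 1)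
    (hζu : ∀ k : ℕ, 0 < k → k < ℓ → IsUnit (ζ ^ k - 1)) (b : B) :
    (∑ k ∈ Finset.range ℓ, ∑ i ∈ Finset.range ℓ, η ^ (k * i) * (σ ^ i) b) = (ℓ : B) * b := by
  have hchar : ∀ i, 0 < i → i < ℓ → (∑ k ∈ Finset.range ℓ, η ^ (k * i)) = 0 := by
    intro i hi hiℓ
    have h1 : (∑ k ∈ Finset.range ℓ, (η ^ i) ^ k) * (η ^ i - 1) = 0 := by
      rw [geom_sum_mul, ← pow_mul, mul_comm, pow_mul, hηℓ, one_pow, sub_self]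
    have hu : IsUnit (η ^ i - 1) := by
      have h2 : η ^ i - 1 = -(η ^ i * (ζ ^ i - 1)) := by
        rw [mul_sub, mul_one, ← mul_pow, hηζ, one_pow]; ring
      rw [h2]
      exact ((IsUnit.of_mul_eq_one ζ hηζ).pow i |>.mul (hζu i hi hiℓ)).neg
    have h3 : (∑ k ∈ Finset.range ℓ, (η ^ i) ^ k) = 0 := (hu.mul_left_eq_zero).mp h1
    rw [← h3]
    exact Finset.sum_congr rfl fun k _ => by rw [← pow_mul, mul_comm]
  rw [Finset.sum_comm]
  have h1 : ∀ i ∈ Finset.range ℓ,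
      (∑ k ∈ Finset.range ℓ, η ^ (k * i) * (σ ^ i) b) =
        (∑ k ∈ Finset.range ℓ, η ^ (k * i)) * (σ ^ i) b := fun i _ => by rw [Finset.sum_mul]
  rw [Finset.sum_congr rfl h1]
  obtain ⟨m, hm⟩ : ∃ m, ℓ = m + 1 := ⟨ℓ - 1, by omega⟩
  rw [hm, Finset.sum_range_succ' (fun i => (∑ k ∈ Finset.range (m + 1), η ^ (k * i)) * (σ ^ i) b),
    ← hm]
  have h2 : ∀ i ∈ Finset.range m,
      (∑ k ∈ Finset.range ℓ, η ^ (k * (i + 1))) * (σ ^ (i + 1)) b = 0 := by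
    intro i hi
    rw [hchar (i + 1) (Nat.succ_pos i)
      (by rw [hm]; exact Nat.succ_lt_succ (Finset.mem_range.mp hi)), zero_mul]
  rw [Finset.sum_eq_zero h2, zero_add]
  simp

/-! ## The fixed subring -/

variable (A : Subring B) (hA : ∀ b : B, b ∈ A ↔ σ b = b)
include hA

/-- An element of the fixed subring which is a unit of `B` is a unit of the fixed subring (its
inverse is fixed). [folklore] -/
private theorem isUnit_fixedSubring_iff (a : A) : IsUnit a ↔ IsUnit (a : B) := by
  refine ⟨fun h => h.map A.subtype, fun h => ?_⟩
  obtain ⟨v, hv⟩ := h.exists_right_inv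
  have hσv : σ v = v := by
    have h1 : (a : B) * σ v = 1 := by
      have := congrArg σ hv
      rwa [map_mul, (hA a).mp a.2, map_one] at this
    calc σ v = σ v * ((a : B) * v) := by rw [hv, mul_one]
      _ = ((a : B) * σ v) * v := by ring
      _ = v := by rw [h1, one_mul]
  exact IsUnit.of_mul_eq_one (⟨v, (hA v).mpr hσv⟩ : A) (Subtype.ext hv)

/-- **The fixed subring of an automorphism of a local ring is local**, with the units of `A` the
units of `B` lying in `A` (in the source: "`R₁ := S₁^G`. Then `R₁` is a normal local model of `V/k`
and `S₁` lies above `R₁`", proof of Lemma 9.4).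
[cite: CossartPiltant2008, proof of Lemma 9.4 (HAL p. 29), "`R₁` is a normal local model"] -/
theorem isLocalRing_fixedSubring [IsLocalRing B] : IsLocalRing A := by
  haveI : Nontrivial A := A.subtype.domain_nontrivial
  refine IsLocalRing.of_nonunits_add fun a b ha hb => ?_
  rw [mem_nonunits_iff, isUnit_fixedSubring_iff σ A hA, ← mem_nonunits_iff,
    ← IsLocalRing.mem_maximalIdeal] at ha hb ⊢
  exact Ideal.add_mem _ ha hb

variable {ℓ : ℕ} (hℓ0 : ℓ ≠ 0) (hσℓ : σ ^ ℓ = 1) (hℓu : IsUnit ((ℓ : B)))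
  (ζ : B) (hσζ : σ ζ = ζ) (hζℓ : ζ ^ ℓ = 1) (hζu : ∀ k : ℕ, 0 < k → k < ℓ → IsUnit (ζ ^ k - 1))
include hℓ0 hσℓ hℓu hσζ hζℓ hζu

omit hζu in
/-- KEY LEMMA: a weight-`k` eigenvector of `σ` lying in the ideal of `B` generated by a finite set
`s` of weight-`k` eigenvectors is an `A`-linear combination of `s` (apply the twisted Reynolds
operator `P_k`: `ℓ x = P_k x = ∑_{e ∈ s} P₀(c_e) e`). [folklore] -/
private theorem eigen_mem_span_fixedSubring {k : ℕ} (s : Finset B) (hs : ∀ e ∈ s, σ e = ζ ^ k * e)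
    {x : B} (hx : σ x = ζ ^ k * x) (hxs : x ∈ Ideal.span (s : Set B)) :
    x ∈ Submodule.span A (s : Set B) := by
  classical
  have hℓpos : 0 < ℓ := Nat.pos_of_ne_zero hℓ0
  -- `η = ζ⁻¹`
  set η : B := ζ ^ (ℓ - 1) with hηdef
  have hηζ : η * ζ = 1 := by rw [hηdef, ← pow_succ, Nat.sub_add_cancel hℓpos, hζℓ]
  obtain ⟨u, hu⟩ := hℓu.exists_left_inv
  have hσu : σ u = u := by
    have h1 : σ u * (ℓ : B) = 1 := by
      have := congrArg σ hu
      rwa [map_mul, map_natCast, map_one] at this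
    calc σ u = σ u * ((ℓ : B) * u) := by rw [mul_comm (ℓ : B), hu, mul_one]
      _ = (σ u * (ℓ : B)) * u := by ring
      _ = u := by rw [h1, one_mul]
  have huA : u ∈ A := (hA u).mpr hσu
  -- write `x` over `s` with coefficients in `B`
  obtain ⟨f, -, hf⟩ := Submodule.mem_span_finset.mp hxs
  simp only [smul_eq_mul] at hf
  -- apply `P_k`: `ℓ x = ∑_{e ∈ s} P₀(f e) e`
  have hPx : (∑ i ∈ Finset.range ℓ, η ^ (k * i) * (σ ^ i) x) = (ℓ : B) * x := by
    have := twistedSum_mul_eigen σ (ℓ := ℓ) hηζ hσζ hx 1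
    rw [one_mul] at this
    rw [this]
    congr 1
    simp
  have hkey : (ℓ : B) * x = ∑ e ∈ s, (∑ i ∈ Finset.range ℓ, (σ ^ i) (f e)) * e := by
    rw [← hPx, ← hf]
    simp only [map_sum, Finset.mul_sum]
    rw [Finset.sum_comm]
    refine Finset.sum_congr rfl fun e he => ?_
    exact twistedSum_mul_eigen σ hηζ hσζ (hs e he) (f e)
  -- the coefficients `u P₀(f e)` lie in `A`
  have hcoefA : ∀ e, u * ∑ i ∈ Finset.range ℓ, (σ ^ i) (f e) ∈ A := fun e =>
    A.mul_mem huA ((hA _).mpr (apply_sum_pow_apply σ hℓ0 hσℓ (f e)))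
  have hx' : x = ∑ e ∈ s, (⟨_, hcoefA e⟩ : A) • e := by
    calc x = u * ((ℓ : B) * x) := by rw [← mul_assoc, hu, one_mul]
      _ = ∑ e ∈ s, (u * ∑ i ∈ Finset.range ℓ, (σ ^ i) (f e)) * e := by
          rw [hkey, Finset.mul_sum]
          exact Finset.sum_congr rfl fun e _ => by ring
      _ = ∑ e ∈ s, (⟨_, hcoefA e⟩ : A) • e := rfl
  rw [hx']
  exact Submodule.sum_mem _ fun e he => Submodule.smul_mem _ _ (Submodule.subset_span he)

/-- **`B` is a finite module over the fixed subring of a tame cyclic automorphism** (`B`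
Noetherian): `b = ℓ⁻¹ ∑_k P_k b`, each `P_k b` is a weight-`k` eigenvector, and the weight-`k`
eigenvectors are `A`-combinations of finitely many of them (`eigen_mem_span_fixedSubring` with
generators of the ideal they span). In the source this is "`S₁` lies above `R₁ := S₁^G`" (`S₁` is
a localization of a finite `R₁`-algebra), proof of Lemma 9.4.
[cite: CossartPiltant2008, proof of Lemma 9.4 (HAL p. 29), "`S₁` lies above `R₁`"] -/
theorem module_finite_fixedSubring_of_tameCyclic [IsNoetherianRing B] : Module.Finite A B := by
  classical
  have hℓpos : 0 < ℓ := Nat.pos_of_ne_zero hℓ0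
  set η : B := ζ ^ (ℓ - 1) with hηdef
  have hηζ : η * ζ = 1 := by rw [hηdef, ← pow_succ, Nat.sub_add_cancel hℓpos, hζℓ]
  have hηℓ : η ^ ℓ = 1 := by rw [hηdef, ← pow_mul, mul_comm, pow_mul, hζℓ, one_pow]
  have hση : σ η = η := by rw [hηdef, map_pow, hσζ]
  obtain ⟨u, hu⟩ := hℓu.exists_left_inv
  -- finitely many weight-`k` eigenvectors generating the weight-`k` eigen-ideal
  have hgen : ∀ k : ℕ, ∃ s : Finset B, (∀ e ∈ s, σ e = ζ ^ k * e) ∧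
      ∀ x : B, σ x = ζ ^ k * x → x ∈ Ideal.span (s : Set B) := by
    intro k
    let E : Set B := {e | σ e = ζ ^ k * e}
    have hfg : (Ideal.span E).FG := (isNoetherianRing_iff_ideal_fg B).mp inferInstance _
    obtain ⟨s, hsE, hspan⟩ := (Submodule.fg_span_iff_fg_span_finset_subset E).mp hfg
    refine ⟨s, fun e he => hsE he, fun x hx => ?_⟩
    have : x ∈ Ideal.span E := Ideal.subset_span hx
    change x ∈ Submodule.span B E at this
    rwa [hspan] at this
  choose s hs hsspan using hgen
  let S : Finset B := (Finset.range ℓ).biUnion s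
  refine Module.finite_def.mpr ⟨S, ?_⟩
  rw [eq_top_iff]
  rintro b -
  -- `b = ∑_k u • P_k b` with `P_k b ∈ span_A (s k)`
  have hPk : ∀ k ∈ Finset.range ℓ, (∑ i ∈ Finset.range ℓ, η ^ (k * i) * (σ ^ i) b) ∈
      Submodule.span A (S : Set B) := by
    intro k hk
    have hPkb := apply_twistedSum σ hℓ0 hσℓ hηζ hση hηℓ k b
    have h1 := eigen_mem_span_fixedSubring σ A hA hℓ0 hσℓ hℓu ζ hσζ hζℓ (s k) (hs k)
      hPkb (hsspan k _ hPkb)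
    refine Submodule.span_mono ?_ h1
    intro e he
    exact Finset.mem_biUnion.mpr ⟨k, hk, he⟩
  -- `u ∈ A`
  have hσu : σ u = u := by
    have h1 : σ u * (ℓ : B) = 1 := by
      have := congrArg σ hu
      rwa [map_mul, map_natCast, map_one] at this
    calc σ u = σ u * ((ℓ : B) * u) := by rw [mul_comm (ℓ : B), hu, mul_one]
      _ = (σ u * (ℓ : B)) * u := by ring
      _ = u := by rw [h1, one_mul]
  have huA : u ∈ A := (hA u).mpr hσu
  have hb : b = (⟨u, huA⟩ : A) • ∑ k ∈ Finset.range ℓ,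
      ∑ i ∈ Finset.range ℓ, η ^ (k * i) * (σ ^ i) b := by
    change b = u * _
    rw [sum_twistedSum σ hℓ0 hηζ hηℓ hζu b, ← mul_assoc, hu, one_mul]
  rw [hb]
  exact Submodule.smul_mem _ _ (Submodule.sum_mem _ hPk)

omit hζu in
/-- **The fixed subring of a tame cyclic automorphism of a Noetherian ring is Noetherian**:
for an ideal `I` of `A`, `I·B ∩ A = I` by the Reynolds operator, so `I` is generated by the
finitely many elements of `I` needed to generate `I·B`. In the source: "`R₁ := S₁^G`. Then `R₁` is
a normal local model of `V/k`" (a local model is a localization of a finitely generated algebra,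
in particular Noetherian), proof of Lemma 9.4.
[cite: CossartPiltant2008, proof of Lemma 9.4 (HAL p. 29), "`R₁` is a normal local model"] -/
theorem isNoetherianRing_fixedSubring_of_tameCyclic [IsNoetherianRing B] : IsNoetherianRing A := by
  classical
  refine (isNoetherianRing_iff_ideal_fg A).mpr fun I => ?_
  -- generators of `I·B` inside the image of `I`
  let E : Set B := (A.subtype : A → B) '' (I : Set A)
  have hfg : (Ideal.span E).FG := (isNoetherianRing_iff_ideal_fg B).mp inferInstance _
  obtain ⟨s, hsE, hspan⟩ := (Submodule.fg_span_iff_fg_span_finset_subset E).mp hfg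
  have hpre : ∀ e ∈ s, ∃ a : A, a ∈ I ∧ (a : B) = e := fun e he => by
    obtain ⟨a, ha, hae⟩ := hsE he
    exact ⟨a, ha, hae⟩
  choose g hgI hge using hpre
  -- every element of `s` is fixed (weight `0`)
  have hs0 : ∀ e ∈ s, σ e = ζ ^ 0 * e := fun e he => by
    rw [pow_zero, one_mul, ← hge e he]
    exact (hA _).mp (g e he).2
  let t : Finset A := s.attach.image fun e => g e.1 e.2
  refine ⟨t, le_antisymm ?_ ?_⟩
  · rw [Ideal.span_le]
    intro a ha
    obtain ⟨e, -, rfl⟩ := Finset.mem_image.mp (Finset.mem_coe.mp ha)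
    exact hgI e.1 e.2
  · intro a haI
    have haE : (a : B) ∈ Ideal.span E := Ideal.subset_span ⟨a, haI, rfl⟩
    have has : (a : B) ∈ Ideal.span (s : Set B) := by
      change (a : B) ∈ Submodule.span B E at haE
      rwa [hspan] at haE
    have ha0 : σ (a : B) = ζ ^ 0 * (a : B) := by rw [pow_zero, one_mul]; exact (hA _).mp a.2
    have hmem := eigen_mem_span_fixedSubring σ A hA hℓ0 hσℓ hℓu ζ hσζ hζℓ s hs0 ha0 has
    -- `a = ∑_{e ∈ s} c_e • e` with `c_e ∈ A`, i.e. `a = ∑ c_e * g e` in `A`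
    obtain ⟨c, -, hc⟩ := Submodule.mem_span_finset.mp hmem
    have ha : a = ∑ e ∈ s.attach, c e.1 * g e.1 e.2 := by
      apply Subtype.ext
      rw [← hc]
      simp only [AddSubmonoidClass.coe_finsetSum, Subring.coe_mul]
      rw [← Finset.sum_attach s (fun e => c e • e)]
      refine Finset.sum_congr rfl fun e _ => ?_
      rw [hge e.1 e.2, Algebra.smul_def]
      rfl
    rw [ha]
    refine Ideal.sum_mem _ fun e he => Ideal.mul_mem_left _ _ (Ideal.subset_span ?_)
    exact Finset.mem_coe.mpr (Finset.mem_image.mpr ⟨e, he, rfl⟩)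

omit hσζ hζℓ hζu in
/-- **Residual triviality gives equal residue fields**: if `σ b − b ∈ 𝔪_B` for all `b` (the
automorphism lies in the inertia group), then every `b ∈ B` is congruent modulo `𝔪_B` to an
element of the fixed subring, namely `ℓ⁻¹ P₀ b` ([CoP1] Prop. 6.2 (2), (27): "`κ(Rʳ) = κ(Rⁱ)`").
[cite: CossartPiltant2008, Prop. 6.2 (2) (27)] -/
theorem exists_sub_mem_maximalIdeal_of_residuallyTrivial [IsLocalRing B]
    (hres : ∀ b : B, σ b - b ∈ maximalIdeal B) (b : B) :
    ∃ a : A, b - (a : B) ∈ maximalIdeal B := by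
  classical
  obtain ⟨u, hu⟩ := hℓu.exists_left_inv
  have hσu : σ u = u := by
    have h1 : σ u * (ℓ : B) = 1 := by
      have := congrArg σ hu
      rwa [map_mul, map_natCast, map_one] at this
    calc σ u = σ u * ((ℓ : B) * u) := by rw [mul_comm (ℓ : B), hu, mul_one]
      _ = (σ u * (ℓ : B)) * u := by ring
      _ = u := by rw [h1, one_mul]
  have huA : u ∈ A := (hA u).mpr hσu
  have hP0A : u * ∑ i ∈ Finset.range ℓ, (σ ^ i) b ∈ A :=
    A.mul_mem huA ((hA _).mpr (apply_sum_pow_apply σ hℓ0 hσℓ b))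
  refine ⟨⟨_, hP0A⟩, ?_⟩
  -- `b − u P₀ b = u ∑ᵢ (b − σⁱ b)`
  have hpow : ∀ i : ℕ, b - (σ ^ i) b ∈ maximalIdeal B := by
    intro i
    induction i with
    | zero => simp
    | succ i ih =>
      have h1 : b - (σ ^ (i + 1)) b = (b - σ b) + σ (b - (σ ^ i) b) := by
        rw [map_sub, pow_succ', RingAut.mul_apply]; ring
      rw [h1]
      refine Ideal.add_mem _ ?_ ?_
      · have h := (maximalIdeal B).neg_mem (hres b)
        rwa [neg_sub] at h
      · have h := pow_apply_mem_maximalIdeal σ 1 ih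
        simpa using h
  have h2 : b - u * ∑ i ∈ Finset.range ℓ, (σ ^ i) b =
      u * ∑ i ∈ Finset.range ℓ, (b - (σ ^ i) b) := by
    rw [Finset.sum_sub_distrib, Finset.sum_const, Finset.card_range, nsmul_eq_mul, mul_sub,
      ← mul_assoc, hu, one_mul]
  change b - u * ∑ i ∈ Finset.range ℓ, (σ ^ i) b ∈ maximalIdeal B
  rw [h2]
  exact Ideal.mul_mem_left _ _ (Ideal.sum_mem _ fun i _ => hpow i)

/-- **The fixed subring of a tame cyclic automorphism acting by a pseudo-reflection on a regular
local ring is regular** — brick 1 (`isRegularLocalRing_of_fixed_pseudoReflection`) with its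
standing hypotheses on `A` discharged: for `B` regular local of dimension `d + 1`, `σ` with
`σ^ℓ = 1`, `ℓ ∈ Bˣ`, `ζ ∈ B` fixed by `σ` with `ζ^ℓ = 1` and `ζ^k − 1 ∈ Bˣ` (`0 < k < ℓ`),
`σ` residually trivial, and a regular system of parameters `(z₀, z₁, …, z_d)` of `B` with
`σ z₀ = ζ z₀` and `σ zⱼ = zⱼ` (`j ≥ 1`), the fixed subring `A` is a regular local ring whose maximal
ideal is generated by `z₀^ℓ, z₁, …, z_d` ([CoP1] proof of Lemma 9.4: "`Ŝ₁^G = κ(S₁)[[z₁^l, z₂, z₃]]`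
is a regular local ring. Thus `S₁^G` is a local uniformization of `V/k`", HAL p. 29).
[cite: CossartPiltant2008, proof of Lemma 9.4 (HAL p. 29)] -/
theorem isRegularLocalRing_fixedSubring_of_pseudoReflection [IsRegularLocalRing B]
    (hres : ∀ b : B, σ b - b ∈ maximalIdeal B)
    {d : ℕ} (z₀ : B) (z : Fin d → B) (hz : ∀ j, σ (z j) = z j)
    (hspan : Ideal.span (insert z₀ (Set.range z)) = maximalIdeal B)
    (hdim : ringKrullDim B = (d + 1 : ℕ)) (hz₀ : σ z₀ = ζ * z₀) :
    IsRegularLocalRing A ∧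
      ∃ (w₀ : A) (w : Fin d → A), (w₀ : B) = z₀ ^ ℓ ∧ (∀ j, (w j : B) = z j) ∧
        (haveI := isLocalRing_fixedSubring σ A hA;
          Ideal.span (insert w₀ (Set.range w)) = maximalIdeal A) := by
  classical
  haveI : IsLocalRing A := isLocalRing_fixedSubring σ A hA
  haveI : IsNoetherianRing A :=
    isNoetherianRing_fixedSubring_of_tameCyclic σ A hA hℓ0 hσℓ hℓu ζ hσζ hζℓ
  haveI : Module.Finite A B :=
    module_finite_fixedSubring_of_tameCyclic σ A hA hℓ0 hσℓ hℓu ζ hσζ hζℓ hζu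
  -- `σ` as an `A`-algebra automorphism
  let σA : B ≃ₐ[A] B := AlgEquiv.ofRingEquiv (f := σ) fun a => (hA (a : B)).mp a.2
  have hσA : ∀ b, σA b = σ b := fun _ => rfl
  have hσApow : ∀ (n : ℕ) (b : B), (σA ^ n) b = (σ ^ n) b := by
    intro n b
    induction n with
    | zero => rfl
    | succ n ih => rw [pow_succ', AlgEquiv.mul_apply, ih, hσA, pow_succ', RingAut.mul_apply]
  have hσAℓ : σA ^ ℓ = 1 := by
    ext b
    rw [hσApow, hσℓ, AlgEquiv.one_apply, RingAut.one_apply]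
  -- the data in `A`
  have hζA : ζ ∈ A := (hA ζ).mpr hσζ
  let ζ' : A := ⟨ζ, hζA⟩
  have hℓuA : IsUnit ((ℓ : A)) := by
    rw [isUnit_fixedSubring_iff σ A hA]
    simpa using hℓu
  have hζ'ℓ : ζ' ^ ℓ = 1 := Subtype.ext (by simpa using hζℓ)
  have hζ'u : ∀ k : ℕ, 0 < k → k < ℓ → IsUnit (ζ' ^ k - 1) := fun k hk hkℓ => by
    rw [isUnit_fixedSubring_iff σ A hA]
    simpa using hζu k hk hkℓ
  have hfix : ∀ b : B, σA b = b → b ∈ Set.range (algebraMap A B) := fun b hb =>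
    ⟨⟨b, (hA b).mpr hb⟩, rfl⟩
  have hres' : ∀ b : B, ∃ a : A, b - algebraMap A B a ∈ maximalIdeal B :=
    exists_sub_mem_maximalIdeal_of_residuallyTrivial σ A hA hℓ0 hσℓ hℓu hres
  let w : Fin d → A := fun j => ⟨z j, (hA _).mpr (hz j)⟩
  have hspan' : Ideal.span (insert z₀ (Set.range fun j => algebraMap A B (w j))) =
      maximalIdeal B := by
    have h : (fun j => algebraMap A B (w j)) = z := rfl
    rw [h, hspan]
  have hz₀' : σA z₀ = algebraMap A B ζ' * z₀ := hz₀
  obtain ⟨hreg, w₀, hw₀, hmA⟩ :=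
    isRegularLocalRing_of_fixed_pseudoReflection (A := A) (B := B) Subtype.val_injective σA hℓ0
      hσAℓ hℓuA ζ' hζ'ℓ hζ'u hfix hres' z₀ w hspan' hdim hz₀'
  exact ⟨hreg, w₀, w, hw₀, fun j => rfl, hmA⟩

end FixedRing

end Literature.AlgebraicGeometry.Resolution

end
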